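import Mathlib
import Summits.ValiantsHypothesis.ValiantsHypothesis.Theses.FreeSubtorus
import Summits.ValiantsHypothesis.ValiantsHypothesis.Cruxes.OrbitDimensionBound.Lines.RowTorusLadder
import Literature.Computability.AlgebraicComplexity.LandsbergRessayreProofs
import Literature.Computability.AlgebraicComplexity.GrenetEquivariant
import Literature.Computability.AlgebraicComplexity.GenericTorusGrading
import Summits.ValiantsHypothesis.ValiantsHypothesis.Theorems.FreeSubtorusConfusionCoveringGenericElement
import Summits.ValiantsHypothesis.ValiantsHypothesis.Theorems.FreeSubtorusRowTorusRowGradedForm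

/-!
# Line `row_torus` — skeleton for the rung `RowShadow` (one-sided / row-torus covering bound)

Crux advanced: `OrbitDimensionBound` (stmt-ValiantsHypothesis-16133) of `route-ValiantsHypothesis-FreeSubtorus`; floor
`SubtorusCovering` (PROVED, `subtorusCovering_proof`); rung `RowTorus.RowShadow` (`Lines/RowTorusLadder.lean`).

THE LINE.  `RowShadow ⇐ RowRankCovering ⇐ OneSidedRowCovering` (proved in the ladder file: restrict `T_Λ` to
`T_{Λ_R} × 1`), and `OneSidedRowCovering` from three registered stubs:
* `stub_genericElement` (M; VERBATIM the floor's birth stub 1 = gen-1 `Confusion.Line` stub 1 — one proof closes all):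
  a generic element of the identity component of a subtorus with zero row-sums separates characters exactly modulo the
  saturation.  Used here through `Λ' = (L ; 0)`: its ROW half is a generic element of `T_L` (`genericRow_of`).
* `stub_rowGradedForm` (M/L; NEW, provable): for ANY affine matrix `B` and any pair `(g, h) ∈ GL_m²` with `g B₀ = B₀ h` and
  `g B_{kl} = d_k B_{kl} h`, bases adapted to the generalised eigenspaces of `h` (columns) and `g` (rows) put `B` in
  `d`-GRADED BIPARTITE FORM: entry `(i,j)` = constant supported on `β_i = α_j` + row-`k` linear forms supported on
  `β_i = d_k α_j` (`IsRowGraded`).  Tools: `map_maxGenEigenspace_le_of_comp_eq_smul` (tree, GenericTorusGrading),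
  `Module.End.iSup_maxGenEigenspace_eq_top`, `DirectSum.IsInternal.collectedBasis`.  No genericity, no regularity needed.
* `stub_gradedCount` (L+; NEW — the load-bearing, OPEN core): a `d`-graded bipartite affine matrix of size `m` with
  `det = c · per_n` (`c ≠ 0`), `d` generic for a zero-sum lattice `L`, has `C(n,⌊n/2⌋) ≤ m · 2^{rk_ℚ L}`.  At `rk L = 0`
  this contains "unordered row-set-multilinear ABPs for `per_n` have size `≥ C(n,⌊n/2⌋)`" (Kush 2026: the next frontier
  past the min-partition-rank barrier), in determinantal (graded-bipartite) clothing.  Why it might fail: a sub-Grenet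
  row-torus-equivariant representation of some `per_n` (none known; `dc(per_4)` undetermined, HI16).
Composition `OneSidedRowCovering_of`, `RowRankCovering_of`, `RowShadow_of`: kernel-checked below, sorries ONLY in `stub_*`.

Disproof used (`Cruxes/OrbitDimensionBound/Disproof.lean`): its theorems concern the symmetrisation crux; this line's
relaxed target `OrbitRowBound` asks for a NEW matrix `B` (not in place), consistent with §4 (`not_inPlaceHomothety`,
`not_orbitDimensionBoundInPlace`: symmetry cannot be imposed in place) and with §3 (row subtori with zero-sum `L` contain
the homotheties `d = μ·1`, so `OrbitRowBound ⇒ HomothetySymmetrisation` as any proof must); no `-- Targets` stub of §6 is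
instantiated here.  [cite: LandsbergRessayre2017, Thm. 2.8, §6] [cite: Grenet2011] [cite: Vonzurgathen1987, Thm. 3.1]
-/

set_option linter.dupNamespace false

noncomputable section

namespace Summit.ValiantsHypothesis.ValiantsHypothesis.Cruxes.OrbitDimensionBound.RowTorus.Line

open Matrix MvPolynomial Finset
open Literature.Computability.AlgebraicComplexity LRPencil
open Summit.ValiantsHypothesis.ValiantsHypothesis.Cruxes.OrbitDimensionBound.Confusion
open Summit.ValiantsHypothesis.ValiantsHypothesis.Cruxes.OrbitDimensionBound.RowTorus

/-! ## §1 Statements of the stubs -/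

/-- Statement of stub 1 (`stub_genericElement`) — VERBATIM the floor's birth stub 1 and gen-1's `Confusion.Line` stub 1:
a generic element `(d, e)` of the identity component of `T_Λ` (zero ROW sums suffice): relations hold, no closed walk,
exact separation modulo `Λ_sat`. [cite: LandsbergRessayre2017, §6] -/
def Stmt.stub_genericElement : Prop :=
  ∀ (n r : ℕ) (Λ : Fin r → (Fin n ⊕ Fin n) → ℤ),
    (∀ i, (∑ k, Λ i (Sum.inl k)) = 0) →
    ∃ d e : Fin n → ℂˣ,
      (∀ i, (∏ k, (d k) ^ (Λ i (Sum.inl k))) * (∏ l, (e l) ^ (Λ i (Sum.inr l))) = 1) ∧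
      (∀ u : Fin n × Fin n → ℕ, u ≠ 0 → (∏ p, ((d p.1 : ℂ) * (e p.2 : ℂ)) ^ (u p)) ≠ 1) ∧
      (∀ χ : (Fin n ⊕ Fin n) → ℤ,
        (∏ k, (d k) ^ (χ (Sum.inl k))) * (∏ l, (e l) ^ (χ (Sum.inr l))) = 1 →
        ∃ (N : ℤ) (a : Fin r → ℤ), N ≠ 0 ∧ N • χ = ∑ i, a i • Λ i)

/-- **`d`-graded bipartite form.**  `B` is GRADED w.r.t. row weights `d : (ℂˣ)ⁿ`, column grades `α` and row grades `β`
(all in `ℂˣ`): every entry `B i j` is `C a₀ + Σ_p a_p X_p` with the constant supported on `β i = α j` and the coefficient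
of `x_{kl}` supported on `β i = d_k · α j`. [cite: LandsbergRessayre2017, §6] -/
def IsRowGraded (n m : ℕ) (d : Fin n → ℂˣ) (α β : Fin m → ℂˣ)
    (B : Matrix (Fin m) (Fin m) (MvPolynomial (Fin n × Fin n) ℂ)) : Prop :=
  ∀ i j, ∃ (a₀ : ℂ) (a : Fin n × Fin n → ℂ),
    B i j = C a₀ + ∑ p, a p • X p ∧
    (a₀ ≠ 0 → β i = α j) ∧
    (∀ p, a p ≠ 0 → β i = d p.1 * α j)

/-- Statement of stub 2 (`stub_rowGradedForm`) — eigenspace-adapted bases: an affine matrix `B` admitting a pair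
`(g, h)` with `g B₀ = B₀ h` and `g B_{kl} = d_k B_{kl} h` is `GL_m(ℂ) × GL_m(ℂ)`-equivalent to a `d`-graded bipartite
matrix (column grades = generalised eigenvalues of `h`, row grades = those of `g`). [cite: LandsbergRessayre2017, §6] -/
def Stmt.stub_rowGradedForm : Prop :=
  ∀ (n m : ℕ) (B : Matrix (Fin m) (Fin m) (MvPolynomial (Fin n × Fin n) ℂ)) (d : Fin n → ℂˣ)
    (g h : GL (Fin m) ℂ),
    (∀ i j, (B i j).totalDegree ≤ 1) →
    (g : Matrix (Fin m) (Fin m) ℂ) * constPart B = constPart B * (h : Matrix (Fin m) (Fin m) ℂ) →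
    (∀ p : Fin n × Fin n, (g : Matrix (Fin m) (Fin m) ℂ) * coeffMat B p =
        (d p.1 : ℂ) • (coeffMat B p * (h : Matrix (Fin m) (Fin m) ℂ))) →
    ∃ (P Q : GL (Fin m) ℂ) (α β : Fin m → ℂˣ),
      IsRowGraded n m d α β
        ((P : Matrix (Fin m) (Fin m) ℂ).map C * B * (Q : Matrix (Fin m) (Fin m) ℂ).map C)

/-- Statement of stub 3 (`stub_gradedCount`) — **the graded count** (the open core): a `d`-graded bipartite affine matrix
of size `m` with `det = c · per_n`, `c ≠ 0`, `n ≥ 3`, where `d` separates characters exactly modulo the saturation of a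
zero-sum lattice `L`, satisfies `C(n,⌊n/2⌋) ≤ m · 2^{rk_ℚ L}`. [cite: LandsbergRessayre2017, Question 2.2] [cite: Grenet2011] -/
def Stmt.stub_gradedCount : Prop :=
  ∀ (n m ρ : ℕ) (L : Fin ρ → Fin n → ℤ) (d : Fin n → ℂˣ) (α β : Fin m → ℂˣ)
    (B : Matrix (Fin m) (Fin m) (MvPolynomial (Fin n × Fin n) ℂ)) (c : ℂ),
    3 ≤ n →
    (∀ i, (∑ k, L i k) = 0) →
    (∀ χ : Fin n → ℤ, (∏ k, (d k) ^ (χ k)) = 1 → ∃ (N : ℤ) (a : Fin ρ → ℤ), N ≠ 0 ∧ N • χ = ∑ i, a i • L i) →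
    IsRowGraded n m d α β B →
    c ≠ 0 → B.det = C c * perPoly (Fin n) ℂ →
    n.choose (n / 2) ≤ m * 2 ^ latticeRank n ρ L

/-! ## §2 Registered stubs (the ONLY sorries of this file) -/

/-- **Registered stub 1 = `Stmt.stub_genericElement`** (size M; shared verbatim with the floor's birth line and gen-1's
line `confusion_covering`). [cite: LandsbergRessayre2017, §6] -/
theorem stub_genericElement : Stmt.stub_genericElement :=
  -- LANDED (p177811, fwd2-land-2); closed by name — wired 2026-08-28 by val-width-16133-w1 g2
  Summit.ValiantsHypothesis.ValiantsHypothesis.Theorems.FreeSubtorusConfusionCovering.stub_genericElement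

/-- **Registered stub 2 = `Stmt.stub_rowGradedForm`** (size M/L; NEW; generalised-eigenspace bookkeeping).
[cite: LandsbergRessayre2017, §6] -/
theorem stub_rowGradedForm : Stmt.stub_rowGradedForm :=
  -- LANDED (p177997, fwd2-land-2); closed by name — wired 2026-08-28 by val-width-16133-w1 g2
  Summit.ValiantsHypothesis.ValiantsHypothesis.Theorems.FreeSubtorusRowTorus.stub_rowGradedForm

/-- **Registered stub 3 = `Stmt.stub_gradedCount`** (size L+; NEW; the load-bearing step).
[cite: LandsbergRessayre2017, Question 2.2] -/
theorem stub_gradedCount : Stmt.stub_gradedCount := by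
  sorry

/-! ## §3 The composition (kernel-checked, sorry-free) -/

/-- Summing a family against a row of a diagonal matrix picks out the diagonal entry. [folklore] -/
theorem sum_diagonal_smul {ι M : Type*} [Fintype ι] [DecidableEq ι] [AddCommMonoid M] [Module ℂ M]
    (c : ι → ℂ) (B : ι → M) (v : ι) :
    ∑ i, (Matrix.diagonal c) v i • B i = c v • B v := by
  rw [Finset.sum_eq_single v]
  · rw [Matrix.diagonal_apply_eq]
  · intro i _ hi
    rw [Matrix.diagonal_apply_ne _ (Ne.symm hi), zero_smul]
  · intro hv
    exact absurd (Finset.mem_univ v) hv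

/-- **A generic ROW element from stub 1**: apply the two-sided statement to `Λ' = (L ; 0)` and keep the row half.
[cite: LandsbergRessayre2017, §6] -/
theorem genericRow_of (hGE : Stmt.stub_genericElement) (n ρ : ℕ) (L : Fin ρ → Fin n → ℤ)
    (hL : ∀ i, (∑ k, L i k) = 0) :
    ∃ d : Fin n → ℂˣ, (∀ i, (∏ k, (d k) ^ (L i k)) = 1) ∧
      (∀ χ : Fin n → ℤ, (∏ k, (d k) ^ (χ k)) = 1 →
        ∃ (N : ℤ) (a : Fin ρ → ℤ), N ≠ 0 ∧ N • χ = ∑ i, a i • L i) := by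
  obtain ⟨d, e, hrel, -, hsep⟩ := hGE n ρ (fun i => Sum.elim (L i) 0) (fun i => by simpa using hL i)
  refine ⟨d, fun i => by simpa using hrel i, fun χ hχ => ?_⟩
  obtain ⟨N, a, hN, hNa⟩ := hsep (Sum.elim χ 0) (by simpa using hχ)
  refine ⟨N, a, hN, funext fun k => ?_⟩
  have hk := congrFun hNa (Sum.inl k)
  simpa [Finset.sum_apply, Pi.smul_apply] using hk

/-- **`OneSidedRowCovering` from the three stubs** (real proof): (1) generic row element `d ∈ T_L` (stub 1 via
`genericRow_of`); (2) `diag(d_k) ∈ T_L × 1`; (3) its exact lift `(g, h)` read on coefficient matrices; (4) stub 2: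
graded bipartite form of `P B Q`; (5) `det (P B Q) = det P det Q · per_n`; (6) stub 3. [cite: LandsbergRessayre2017, §6] -/
theorem OneSidedRowCovering_of :
    Stmt.stub_genericElement → Stmt.stub_rowGradedForm → Stmt.stub_gradedCount → OneSidedRowCovering := by
  intro hGE hGF hGC
  unfold Stmt.stub_rowGradedForm at hGF
  unfold Stmt.stub_gradedCount at hGC
  intro n hn m ρ L B hL hB
  classical
  have haff : ∀ i j, (B i j).totalDegree ≤ 1 := hB.1.1
  have hdet : B.det = perPoly (Fin n) ℂ := hB.1.2
  -- (1) a generic ROW element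
  obtain ⟨d, hrel, hsep⟩ := genericRow_of hGE n ρ L hL
  -- (2) the torus element `x_{kl} ↦ d_k x_{kl}` as an element of `GL(n²)`, a generator of `T_L × 1`
  have hd0 : ∀ p : Fin n × Fin n, ((fun p : Fin n × Fin n => (d p.1 : ℂ)) p) ≠ 0 := fun p => (d p.1).ne_zero
  let γ : GL (Fin n × Fin n) ℂ := Grenet.diagUnit (fun p : Fin n × Fin n => (d p.1 : ℂ)) hd0
  have hγcoe : (γ : Matrix (Fin n × Fin n) (Fin n × Fin n) ℂ) =
      Matrix.diagonal (fun p : Fin n × Fin n => (d p.1 : ℂ)) := rfl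
  have hγmem : γ ∈ rowTorus n ρ L := Subgroup.subset_closure ⟨d, hrel, hγcoe⟩
  -- (3) its exact lift `(g, h)`: `g B₀ = B₀ h` and `g B_p = d_{p.1} B_p h`
  obtain ⟨g, h, hgh, hΛ0⟩ := hB.exists_lift_stabilising hγmem
  have hAv : ∀ p : Fin n × Fin n, (g : Matrix (Fin m) (Fin m) ℂ) * coeffMat B p =
      (d p.1 : ℂ) • (coeffMat B p * (h : Matrix (Fin m) (Fin m) ℂ)) := by
    intro p
    have e1 : coeffMat (Matrix.linSubstEntries γ B) p =
        coeffMat ((g : Matrix (Fin m) (Fin m) ℂ).map C * B *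
          ((h⁻¹ : GL (Fin m) ℂ) : Matrix (Fin m) (Fin m) ℂ).map C) p := by rw [hgh]
    rw [coeffMat_linSubstEntries _ _ haff, hγcoe, sum_diagonal_smul, coeffMat_C_mul_mul_C] at e1
    rw [mul_eq_of_eq_mul_mul_inv e1, Matrix.smul_mul]
  -- (4) stub 2: graded bipartite form of `P B Q`
  obtain ⟨P, Q, α, β, hgr⟩ := hGF n m B d g h haff hΛ0 hAv
  -- (5) the determinant of `P B Q`
  have hdetP : ((P : Matrix (Fin m) (Fin m) ℂ).map (C : ℂ →+* MvPolynomial (Fin n × Fin n) ℂ)).det =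
      C (P : Matrix (Fin m) (Fin m) ℂ).det := by
    rw [← RingHom.mapMatrix_apply, ← RingHom.map_det]
  have hdetQ : ((Q : Matrix (Fin m) (Fin m) ℂ).map (C : ℂ →+* MvPolynomial (Fin n × Fin n) ℂ)).det =
      C (Q : Matrix (Fin m) (Fin m) ℂ).det := by
    rw [← RingHom.mapMatrix_apply, ← RingHom.map_det]
  have hdet' : ((P : Matrix (Fin m) (Fin m) ℂ).map C * B * (Q : Matrix (Fin m) (Fin m) ℂ).map C).det =
      C ((P : Matrix (Fin m) (Fin m) ℂ).det * (Q : Matrix (Fin m) (Fin m) ℂ).det) * perPoly (Fin n) ℂ := by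
    rw [Matrix.det_mul, Matrix.det_mul, hdetP, hdetQ, hdet, map_mul]
    ring
  have hc : (P : Matrix (Fin m) (Fin m) ℂ).det * (Q : Matrix (Fin m) (Fin m) ℂ).det ≠ 0 := by
    refine mul_ne_zero ?_ ?_
    · simpa [Matrix.GeneralLinearGroup.val_det_apply] using (Matrix.GeneralLinearGroup.det P).ne_zero
    · simpa [Matrix.GeneralLinearGroup.val_det_apply] using (Matrix.GeneralLinearGroup.det Q).ne_zero
  -- (6) stub 3
  exact hGC n m ρ L d α β _ _ hn hL hsep hgr hc hdet'

/-- **The numeric rung from the three stubs.** [cite: LandsbergRessayre2017, Thm. 2.8, Question 2.2] -/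
theorem RowRankCovering_of :
    Stmt.stub_genericElement → Stmt.stub_rowGradedForm → Stmt.stub_gradedCount → RowRankCovering :=
  fun h₁ h₂ h₃ => rowRankCovering_of_oneSided (OneSidedRowCovering_of h₁ h₂ h₃)

/-- **THE RUNG from the three stubs** (concludes `RowTorus.RowShadow` BY NAME). [cite: LandsbergRessayre2017, Question 2.2] -/
theorem RowShadow_of :
    Stmt.stub_genericElement → Stmt.stub_rowGradedForm → Stmt.stub_gradedCount →
      Summit.ValiantsHypothesis.ValiantsHypothesis.Cruxes.OrbitDimensionBound.RowTorus.RowShadow :=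
  fun h₁ h₂ h₃ => rowShadow_of_oneSided (OneSidedRowCovering_of h₁ h₂ h₃)

/-- **THE SKELETON: the rung modulo exactly the three registered stubs.** [cite: LandsbergRessayre2017, Question 2.2] -/
theorem RowShadow_proof :
    Summit.ValiantsHypothesis.ValiantsHypothesis.Cruxes.OrbitDimensionBound.RowTorus.RowShadow :=
  RowShadow_of stub_genericElement stub_rowGradedForm stub_gradedCount

/-- The floor again, from the stubs (rung ⇒ floor). [cite: LandsbergRessayre2017, Thm. 2.8] -/
theorem floor_of_stubs :
    Stmt.stub_genericElement → Stmt.stub_rowGradedForm → Stmt.stub_gradedCount →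
      Summit.ValiantsHypothesis.ValiantsHypothesis.Theses.FreeSubtorus.SubtorusCovering :=
  fun h₁ h₂ h₃ => subtorusCovering_of_rowRankCovering (RowRankCovering_of h₁ h₂ h₃)

end Summit.ValiantsHypothesis.ValiantsHypothesis.Cruxes.OrbitDimensionBound.RowTorus.Line

end
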